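import Mathlib.MeasureTheory.Covering.BesicovitchVectorSpace
import Mathlib.Probability.Kernel.Disintegration.CondCDF
import Mathlib.Probability.Kernel.Composition.MeasureCompProd
import HarnessLib

/-!
# TP₂ laws on the plane are conditionally increasing: an everywhere stochastically monotone version of the
# conditional law (the kernel behind Sahi positivity of singular TP₂ laws on the unit square)

Support file of the Sahi cell (`prim-sahi`, typer seat, generation 10; `--supports stmt-CriticalPhenomena-4575`).
Mathlib only.  Generation 9 (`SahiLiebSahiContinuumKernel.lean`, `…RealKernel.lean`) proved that every conditionally
increasing law `μ₁ ⊗ₘ κ` (`κ` an EVERYWHERE stochastically increasing Markov kernel) on `[0,1]²` / `ℝ²` is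
Sahi-positive of every order.  This file produces such a kernel version of the conditional law from an INTRINSIC
hypothesis on the joint law, total positivity of order two across cuts (`IsTP2Cut`):
`μ(I₁ × Lᶜ) μ(I₂ × L) ≤ μ(I₁ × L) μ(I₂ × Lᶜ)` for closed intervals `I₁ < I₂` and measurable lower sets `L` — the
conditional laws of the first coordinate given `{Y ∈ L}` and given `{Y ∉ L}` are likelihood-ratio ordered on
intervals; an interval form of positive regression dependence that makes sense for general, possibly singular,
measures; implied by (and strictly weaker than) TP₂ of all rectangle masses (so by an MTP₂ density, or by the FKG
lattice condition of all grid cell weights, `SahiTP2CellFKG.lean`), and equivalent, with this file, to the law being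
conditionally increasing (`MTP₂ ⇒ CIS` for densities is [folklore], e.g. Belzunce–Martínez-Riquelme–Mulero (2016),
§1.3.4; the everywhere monotone Markov-kernel version of the disintegration of a singular law is this work).

Construction (`exists_cisKernel`), for a finite measure `ρ` on `ℝ × ℝ` carried by `ℝ × [y₀, y₁]`:
(1) `ratio_le_ratio`: `IsTP2Cut` makes the ball ratios `ρ(B(a,h) × (-∞,q]) / ρ.fst(B(a,h))` decrease in the centre
for disjoint balls; (2) `goodSet`/`ae_mem_goodSet`: by Besicovitch differentiation (`Besicovitch.ae_tendsto_rnDeriv`)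
they converge `ρ.fst`-a.e. to Mathlib's `preCDF ρ q a`, simultaneously for all rational `q`, so `preCDF` is ANTITONE
on a full-measure good set `G` (`preCDF_anti_of_mem_goodSet`); (3) `envCDF`: the lower monotone envelope
`inf ({preCDF ρ q x : x ∈ G, x ≤ a} ∪ {1})` (`0` below `y₀`) agrees with `preCDF` on `G`, is antitone in `a`
everywhere and a rational Stieltjes point at EVERY `a`, hence a rational conditional kernel CDF of `ρ`
(`isRatCondKernelCDF_envCDF`); (4) Mathlib's `IsCondKernelCDF.toKernel` / `compProd_toKernel` give a Markov kernel
`κ` with `ρ.fst ⊗ₘ κ = ρ` and `a ↦ κ_a((-∞,t])` antitone for every real `t`.  Consequences: `SahiTP2Positivity.lean`.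
-/

noncomputable section

namespace Summit.CriticalPhenomena.PercolationContinuityZ3.Theorems.SahiTP2

open MeasureTheory ProbabilityTheory Set Filter Topology Metric Function
open scoped ENNReal

/-- **TP₂ across cuts** for a measure on a product of two preorders: for closed intervals `[a₁,b₁] < [a₂,b₂]` of the
first coordinate and every measurable lower set `L` of the second,
`μ([a₁,b₁] × Lᶜ) μ([a₂,b₂] × L) ≤ μ([a₁,b₁] × L) μ([a₂,b₂] × Lᶜ)`.
Implied by (strictly weaker than) TP₂ of the rectangle masses, hence by an MTP₂ density and by the FKG lattice condition
of all grid cell weights; an interval form of positive regression dependence for general (singular) laws. [this work] -/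
def IsTP2Cut {α β : Type*} [Preorder α] [Preorder β] [MeasurableSpace α] [MeasurableSpace β]
    (μ : Measure (α × β)) : Prop :=
  ∀ ⦃a₁ b₁ a₂ b₂ : α⦄, b₁ < a₂ → ∀ ⦃L : Set β⦄, IsLowerSet L → MeasurableSet L →
    μ (Icc a₁ b₁ ×ˢ Lᶜ) * μ (Icc a₂ b₂ ×ˢ L) ≤ μ (Icc a₁ b₁ ×ˢ L) * μ (Icc a₂ b₂ ×ˢ Lᶜ)

variable (ρ : Measure (ℝ × ℝ))

/-- The first marginal splits along a cut: `ρ.fst(s) = ρ(s × L) + ρ(s × Lᶜ)`. [folklore] -/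
theorem fst_apply_eq_add {s : Set ℝ} (hs : MeasurableSet s) {L : Set ℝ} (hL : MeasurableSet L) :
    ρ.fst s = ρ (s ×ˢ L) + ρ (s ×ˢ Lᶜ) := by
  rw [Measure.fst_apply hs, ← Set.prod_univ, ← Set.union_compl_self L, Set.prod_union]
  exact measure_union (Set.disjoint_prod.2 (Or.inr disjoint_compl_right)) (hs.prod hL.compl)

/-- An elementary `ℝ≥0∞` rearrangement: if `B₁ A₂ ≤ A₁ B₂` then `A₂/(A₂+B₂) ≤ A₁/(A₁+B₁)` (finite quantities,
`A₁ + B₁ ≠ 0`). [folklore] -/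
theorem div_add_le_div_add {A₁ B₁ A₂ B₂ : ℝ≥0∞} (h : B₁ * A₂ ≤ A₁ * B₂) (h₁ : A₁ + B₁ ≠ 0) (h₁' : A₁ + B₁ ≠ ∞)
    (h₂' : A₂ + B₂ ≠ ∞) : A₂ / (A₂ + B₂) ≤ A₁ / (A₁ + B₁) := by
  by_cases h₂ : A₂ + B₂ = 0
  · have hA₂ : A₂ = 0 := (add_eq_zero.1 h₂).1
    simp [hA₂]
  have key : A₂ * (A₁ + B₁) ≤ A₁ * (A₂ + B₂) := by
    have h' : A₂ * B₁ ≤ A₁ * B₂ := by rw [mul_comm]; exact h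
    rw [mul_add, mul_add, mul_comm A₂ A₁]
    exact add_le_add_right h' (A₁ * A₂)
  calc A₂ / (A₂ + B₂) = A₂ * (A₁ + B₁) / ((A₂ + B₂) * (A₁ + B₁)) := by
        rw [ENNReal.mul_div_mul_right _ _ h₁ h₁']
    _ ≤ A₁ * (A₂ + B₂) / ((A₂ + B₂) * (A₁ + B₁)) := ENNReal.div_le_div_right key _
    _ = A₁ / (A₁ + B₁) := by
        rw [mul_comm A₁ (A₂ + B₂), ENNReal.mul_div_mul_left _ _ h₂ h₂']

/-- **Ball ratios decrease in the centre** under `IsTP2Cut`: for disjoint balls `B(a,h) < B(b,h)` and every `q`,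
`ρ(B(b,h) × (-∞,q]) / ρ.fst(B(b,h)) ≤ ρ(B(a,h) × (-∞,q]) / ρ.fst(B(a,h))` as soon as `ρ.fst(B(a,h)) > 0`. [this work] -/
theorem ratio_le_ratio [IsFiniteMeasure ρ] (hρ : IsTP2Cut ρ) {a b h : ℝ} (hab : a + h < b - h) (q : ℝ)
    (hpos : 0 < ρ.fst (closedBall a h)) :
    ρ.IicSnd q (closedBall b h) / ρ.fst (closedBall b h) ≤
      ρ.IicSnd q (closedBall a h) / ρ.fst (closedBall a h) := by
  rw [Real.closedBall_eq_Icc] at hpos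
  rw [Real.closedBall_eq_Icc, Real.closedBall_eq_Icc,
    Measure.IicSnd_apply _ _ measurableSet_Icc, Measure.IicSnd_apply _ _ measurableSet_Icc,
    fst_apply_eq_add ρ measurableSet_Icc (measurableSet_Iic (a := q)),
    fst_apply_eq_add ρ measurableSet_Icc (measurableSet_Iic (a := q))]
  rw [fst_apply_eq_add ρ measurableSet_Icc (measurableSet_Iic (a := q))] at hpos
  have key : ρ (Icc (a - h) (a + h) ×ˢ (Iic q)ᶜ) * ρ (Icc (b - h) (b + h) ×ˢ Iic q) ≤
      ρ (Icc (a - h) (a + h) ×ˢ Iic q) * ρ (Icc (b - h) (b + h) ×ˢ (Iic q)ᶜ) :=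
    hρ hab (isLowerSet_Iic q) measurableSet_Iic
  exact div_add_le_div_add key hpos.ne' (ENNReal.add_ne_top.2 ⟨measure_ne_top _ _, measure_ne_top _ _⟩)
    (ENNReal.add_ne_top.2 ⟨measure_ne_top _ _, measure_ne_top _ _⟩)

/-- Almost every point has balls of positive mass. [folklore] -/
theorem ae_fst_closedBall_pos : ∀ᵐ a ∂ρ.fst, ∀ h : ℝ, 0 < h → 0 < ρ.fst (closedBall a h) := by
  have hnull : ρ.fst {a | ∃ h : ℝ, 0 < h ∧ ρ.fst (closedBall a h) = 0} = 0 := by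
    refine measure_null_of_locally_null _ fun a ha => ?_
    obtain ⟨h, hh, h0⟩ := ha
    exact ⟨closedBall a h, mem_nhdsWithin_of_mem_nhds (closedBall_mem_nhds a hh), h0⟩
  rw [ae_iff]
  refine measure_mono_null (fun a ha => ?_) hnull
  simp only [mem_setOf_eq, not_forall, not_lt, nonpos_iff_eq_zero, exists_prop] at ha ⊢
  exact ha

variable {ρ}

/-- If `ρ` is carried by `ℝ × [y₀, y₁]` then `ρ(s × (-∞,q]) = ρ.fst(s)` for `q ≥ y₁`. [folklore] -/
theorem IicSnd_eq_fst_of_le {y₀ y₁ : ℝ} (hY : ∀ᵐ p ∂ρ, p.2 ∈ Icc y₀ y₁) {q : ℝ} (hq : y₁ ≤ q) :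
    ρ.IicSnd q = ρ.fst := by
  have hY0 : ρ {p | p.2 ∉ Icc y₀ y₁} = 0 := by simpa using ae_iff.1 hY
  ext s hs
  rw [Measure.IicSnd_apply _ _ hs, Measure.fst_apply hs, ← Set.prod_univ]
  refine le_antisymm (measure_mono (prod_mono le_rfl (subset_univ _))) ?_
  calc ρ (s ×ˢ univ) ≤ ρ (s ×ˢ Iic q ∪ {p | p.2 ∉ Icc y₀ y₁}) := by
        refine measure_mono fun p hp => ?_
        by_cases h2 : p.2 ≤ q
        · exact Or.inl ⟨hp.1, h2⟩
        · refine Or.inr fun hI => h2 (hI.2.trans hq)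
    _ ≤ ρ (s ×ˢ Iic q) + ρ {p | p.2 ∉ Icc y₀ y₁} := measure_union_le _ _
    _ = ρ (s ×ˢ Iic q) := by rw [hY0, add_zero]

/-- If `ρ` is carried by `ℝ × [y₀, y₁]` then `ρ(s × (-∞,q]) = 0` for `q < y₀`. [folklore] -/
theorem IicSnd_eq_zero_of_lt {y₀ y₁ : ℝ} (hY : ∀ᵐ p ∂ρ, p.2 ∈ Icc y₀ y₁) {q : ℝ} (hq : q < y₀) :
    ρ.IicSnd q = 0 := by
  have hY0 : ρ {p | p.2 ∉ Icc y₀ y₁} = 0 := by simpa using ae_iff.1 hY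
  ext s hs
  rw [Measure.IicSnd_apply _ _ hs, Measure.coe_zero, Pi.zero_apply]
  refine measure_mono_null (fun p hp => ?_) hY0
  exact fun hI => not_le.2 hq (hI.1.trans hp.2)

variable (ρ)

/-- **The good set** of a finite measure `ρ` on `ℝ × ℝ` (relative to a window `[y₀, y₁]` for the second
coordinate): the points `a` at which, for every rational `q`, the ball ratios `ρ(B(a,h) × (-∞,q]) / ρ.fst(B(a,h))`
converge to `preCDF ρ q a` as `h → 0⁺`, `q ↦ preCDF ρ q a` is a Stieltjes point with values `≤ 1`, equal to `1`
for `q ≥ y₁` and to `0` for `q < y₀`, and every ball around `a` has positive `ρ.fst`-mass. [this work] -/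
def goodSet (y₀ y₁ : ℝ) : Set ℝ :=
  {a | (∀ q : ℚ, Tendsto (fun h : ℝ => ρ.IicSnd q (closedBall a h) / ρ.fst (closedBall a h)) (𝓝[>] 0)
      (𝓝 (preCDF ρ q a))) ∧
    IsRatStieltjesPoint (fun a q => (preCDF ρ q a).toReal) a ∧ (∀ q : ℚ, preCDF ρ q a ≤ 1) ∧
    (∀ h : ℝ, 0 < h → 0 < ρ.fst (closedBall a h)) ∧
    (∀ q : ℚ, y₁ ≤ (q : ℝ) → preCDF ρ q a = 1) ∧ (∀ q : ℚ, (q : ℝ) < y₀ → preCDF ρ q a = 0)}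

variable {ρ}

/-- **The good set has full `ρ.fst`-measure** (Besicovitch differentiation on `ℝ`, countably many rationals).
[this work] -/
theorem ae_mem_goodSet [IsFiniteMeasure ρ] {y₀ y₁ : ℝ} (hY : ∀ᵐ p ∂ρ, p.2 ∈ Icc y₀ y₁) : ∀ᵐ a ∂ρ.fst, a ∈ goodSet ρ y₀ y₁ := by
  have h1 : ∀ᵐ a ∂ρ.fst, ∀ q : ℚ, Tendsto (fun h : ℝ => ρ.IicSnd q (closedBall a h) / ρ.fst (closedBall a h))
      (𝓝[>] 0) (𝓝 (preCDF ρ q a)) := by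
    rw [ae_all_iff]
    intro q
    haveI : IsFiniteMeasure (ρ.IicSnd q) := Measure.IsFiniteMeasure.IicSnd (ρ := ρ) q
    exact Besicovitch.ae_tendsto_rnDeriv (ρ.IicSnd q) ρ.fst
  have h2 : ∀ᵐ a ∂ρ.fst, IsRatStieltjesPoint (fun a q => (preCDF ρ q a).toReal) a := by
    have h := (isRatCondKernelCDF_preCDF ρ).isRatStieltjesPoint_ae ()
    simp only [Kernel.const_apply] at h
    filter_upwards [h] with a ha using (isRatStieltjesPoint_unit_prod_iff _ a).1 ha
  have h3 := preCDF_le_one ρ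
  have h4 := ae_fst_closedBall_pos ρ
  have h5 : ∀ᵐ a ∂ρ.fst, ∀ q : ℚ, y₁ ≤ (q : ℝ) → preCDF ρ q a = 1 := by
    rw [ae_all_iff]
    intro q
    by_cases hq : y₁ ≤ (q : ℝ)
    · have h : preCDF ρ q =ᵐ[ρ.fst] 1 := by
        unfold preCDF
        rw [IicSnd_eq_fst_of_le hY hq]
        exact Measure.rnDeriv_self ρ.fst
      filter_upwards [h] with a ha using fun _ => ha
    · exact ae_of_all _ fun a h => absurd h hq
  have h6 : ∀ᵐ a ∂ρ.fst, ∀ q : ℚ, (q : ℝ) < y₀ → preCDF ρ q a = 0 := by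
    rw [ae_all_iff]
    intro q
    by_cases hq : (q : ℝ) < y₀
    · have h : preCDF ρ q =ᵐ[ρ.fst] 0 := by
        unfold preCDF
        rw [IicSnd_eq_zero_of_lt hY hq]
        exact Measure.rnDeriv_zero ρ.fst
      filter_upwards [h] with a ha using fun _ => ha
    · exact ae_of_all _ fun a h => absurd h hq
  filter_upwards [h1, h2, h3, h4, h5, h6] with a ha1 ha2 ha3 ha4 ha5 ha6
  exact ⟨ha1, ha2, ha3, ha4, ha5, ha6⟩

/-- **`preCDF` is antitone on the good set** of a TP₂ law: the a.e. limit of decreasing ball ratios.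
[this work] -/
theorem preCDF_anti_of_mem_goodSet [IsFiniteMeasure ρ] (hρ : IsTP2Cut ρ) {y₀ y₁ : ℝ} {a b : ℝ} (ha : a ∈ goodSet ρ y₀ y₁)
    (hb : b ∈ goodSet ρ y₀ y₁) (hab : a ≤ b) (q : ℚ) : preCDF ρ q b ≤ preCDF ρ q a := by
  rcases hab.eq_or_lt with rfl | hlt
  · exact le_rfl
  refine le_of_tendsto_of_tendsto (hb.1 q) (ha.1 q) ?_
  have hpos : (0 : ℝ) < (b - a) / 2 := by linarith
  filter_upwards [Ioo_mem_nhdsGT hpos] with h hh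
  have hh' : a + h < b - h := by linarith [hh.2]
  exact ratio_le_ratio ρ hρ hh' q (ha.2.2.2.1 h hh.1)

/-- The real-valued `preCDF` is antitone on the good set. [this work] -/
theorem preCDF_toReal_anti_of_mem_goodSet [IsFiniteMeasure ρ] (hρ : IsTP2Cut ρ) {y₀ y₁ : ℝ} {a b : ℝ} (ha : a ∈ goodSet ρ y₀ y₁)
    (hb : b ∈ goodSet ρ y₀ y₁) (hab : a ≤ b) (q : ℚ) : (preCDF ρ q b).toReal ≤ (preCDF ρ q a).toReal :=
  ENNReal.toReal_mono ((ha.2.2.1 q).trans_lt ENNReal.one_lt_top).ne (preCDF_anti_of_mem_goodSet hρ ha hb hab q)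

/-- On the good set the real-valued `preCDF` is at most `1`. [folklore] -/
theorem preCDF_toReal_le_one {y₀ y₁ : ℝ} {a : ℝ} (ha : a ∈ goodSet ρ y₀ y₁) (q : ℚ) :
    (preCDF ρ q a).toReal ≤ 1 :=
  ENNReal.toReal_le_of_le_ofReal zero_le_one (by simpa using ha.2.2.1 q)

variable (ρ)

/-- **The lower monotone envelope** of `preCDF` along the good set:
`envCDF ρ y₀ y₁ a q = inf ({preCDF ρ q x : x ∈ G, x ≤ a} ∪ {1})` for `q ≥ y₀`, and `0` for `q < y₀`. [this work] -/
def envCDF (y₀ y₁ : ℝ) (a : ℝ) (q : ℚ) : ℝ :=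
  if (q : ℝ) < y₀ then 0
  else sInf (insert 1 ((fun x => (preCDF ρ q x).toReal) '' {x | x ∈ goodSet ρ y₀ y₁ ∧ x ≤ a}))

variable {ρ}

section Env

variable {y₀ y₁ : ℝ}

/-- The set under the infimum in `envCDF` is bounded below by `0`. [folklore] -/
private theorem bddBelow_set (a : ℝ) (q : ℚ) :
    BddBelow (insert 1 ((fun x => (preCDF ρ q x).toReal) '' {x | x ∈ goodSet ρ y₀ y₁ ∧ x ≤ a})) := by
  refine ⟨0, fun y hy => ?_⟩
  rcases mem_insert_iff.1 hy with rfl | ⟨x, _, rfl⟩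
  · exact zero_le_one
  · exact ENNReal.toReal_nonneg

/-- The set under the infimum in `envCDF` contains `1`. [folklore] -/
private theorem nonempty_set (a : ℝ) (q : ℚ) :
    (insert (1 : ℝ) ((fun x => (preCDF ρ q x).toReal) '' {x | x ∈ goodSet ρ y₀ y₁ ∧ x ≤ a})).Nonempty :=
  ⟨1, mem_insert _ _⟩

/-- The envelope is nonnegative. [this work] -/
theorem envCDF_nonneg (a : ℝ) (q : ℚ) : 0 ≤ envCDF ρ y₀ y₁ a q := by
  unfold envCDF
  split_ifs with h
  · exact le_rfl
  · exact le_csInf (nonempty_set a q) fun y hy => by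
      rcases mem_insert_iff.1 hy with rfl | ⟨x, _, rfl⟩
      · exact zero_le_one
      · exact ENNReal.toReal_nonneg

/-- The envelope is at most `1`. [this work] -/
theorem envCDF_le_one (a : ℝ) (q : ℚ) : envCDF ρ y₀ y₁ a q ≤ 1 := by
  unfold envCDF
  split_ifs with h
  · exact zero_le_one
  · exact csInf_le (bddBelow_set a q) (mem_insert _ _)

/-- On the good set the envelope agrees with `preCDF`. [this work] -/
theorem envCDF_of_mem [IsFiniteMeasure ρ] (hρ : IsTP2Cut ρ) {a : ℝ} (ha : a ∈ goodSet ρ y₀ y₁) (q : ℚ) :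
    envCDF ρ y₀ y₁ a q = (preCDF ρ q a).toReal := by
  unfold envCDF
  split_ifs with h
  · simp [ha.2.2.2.2.2 q h]
  · refine IsLeast.csInf_eq ⟨mem_insert_of_mem _ ⟨a, ⟨ha, le_rfl⟩, rfl⟩, fun y hy => ?_⟩
    rcases mem_insert_iff.1 hy with rfl | ⟨x, hx, rfl⟩
    · exact preCDF_toReal_le_one ha q
    · exact preCDF_toReal_anti_of_mem_goodSet hρ hx.1 ha hx.2 q

/-- The envelope is antitone in the space variable, EVERYWHERE. [this work] -/
theorem envCDF_anti {a b : ℝ} (hab : a ≤ b) (q : ℚ) : envCDF ρ y₀ y₁ b q ≤ envCDF ρ y₀ y₁ a q := by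
  unfold envCDF
  split_ifs with h
  · exact le_rfl
  · refine csInf_le_csInf (bddBelow_set b q) (nonempty_set a q) (insert_subset_insert (image_mono ?_))
    exact fun x hx => ⟨hx.1, hx.2.trans hab⟩

/-- The envelope is monotone in the level variable. [this work] -/
theorem envCDF_mono (a : ℝ) : Monotone (envCDF ρ y₀ y₁ a) := by
  intro q q' hqq'
  have hqq'ℝ : (q : ℝ) ≤ q' := Rat.cast_le.2 hqq'
  by_cases h' : (q' : ℝ) < y₀
  · have h : (q : ℝ) < y₀ := hqq'ℝ.trans_lt h'
    simp only [envCDF, h, h', if_true, le_refl]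
  by_cases h : (q : ℝ) < y₀
  · have h0 := envCDF_nonneg (ρ := ρ) (y₀ := y₀) (y₁ := y₁) a q'
    simp only [envCDF, h, h', if_true, if_false] at h0 ⊢
    exact h0
  simp only [envCDF, h, h', if_false]
  refine le_csInf (nonempty_set a q') fun y hy => ?_
  rcases mem_insert_iff.1 hy with rfl | ⟨x, hx, rfl⟩
  · exact csInf_le (bddBelow_set a q) (mem_insert _ _)
  · refine (csInf_le (bddBelow_set a q) (mem_insert_of_mem _ ⟨x, hx, rfl⟩)).trans ?_
    exact hx.1.2.1.mono hqq'

/-- The envelope equals `1` from `y₁` on. [this work] -/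
theorem envCDF_eq_one (hy : y₀ ≤ y₁) (a : ℝ) {q : ℚ} (hq : y₁ ≤ (q : ℝ)) : envCDF ρ y₀ y₁ a q = 1 := by
  have h : ¬ (q : ℝ) < y₀ := not_lt.2 (hy.trans hq)
  simp only [envCDF, h, if_false]
  have hsub : insert (1 : ℝ) ((fun x => (preCDF ρ q x).toReal) '' {x | x ∈ goodSet ρ y₀ y₁ ∧ x ≤ a}) = {1} := by
    refine Subset.antisymm (insert_subset_iff.2 ⟨mem_singleton _, ?_⟩) (singleton_subset_iff.2 (mem_insert _ _))
    rintro y ⟨x, hx, rfl⟩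
    exact mem_singleton_iff.2 (by simp [hx.1.2.2.2.2.1 q hq])
  rw [hsub, csInf_singleton]

/-- The envelope vanishes below `y₀`. [this work] -/
theorem envCDF_eq_zero {a : ℝ} {q : ℚ} (hq : (q : ℝ) < y₀) : envCDF ρ y₀ y₁ a q = 0 := by
  simp only [envCDF, hq, if_true]

/-- Right-continuity of the envelope along the rationals, at every point. [this work] -/
theorem iInf_rat_gt_envCDF (a : ℝ) (t : ℚ) : ⨅ r : Ioi t, envCDF ρ y₀ y₁ a r = envCDF ρ y₀ y₁ a t := by
  have r₁ : Ioi t := ⟨t + 1, lt_add_one t⟩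
  have hbdd : BddBelow (range fun r : Ioi t => envCDF ρ y₀ y₁ a r) :=
    ⟨0, by rintro y ⟨r, rfl⟩; exact envCDF_nonneg a r⟩
  refine le_antisymm ?_ (le_ciInf fun r => envCDF_mono a (le_of_lt r.2))
  by_cases ht : (t : ℝ) < y₀
  · -- a rational strictly between `t` and `y₀`
    obtain ⟨r, htr, hry⟩ := exists_rat_btwn ht
    have htr' : t < r := Rat.cast_lt.1 htr
    calc ⨅ r : Ioi t, envCDF ρ y₀ y₁ a r ≤ envCDF ρ y₀ y₁ a r := ciInf_le hbdd ⟨r, htr'⟩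
      _ = 0 := envCDF_eq_zero hry
      _ = envCDF ρ y₀ y₁ a t := (envCDF_eq_zero ht).symm
  · have ht' : ∀ r : Ioi t, ¬ ((r : ℚ) : ℝ) < y₀ := fun r h =>
      ht (lt_of_lt_of_le' h (Rat.cast_le.2 (le_of_lt r.2)))
    simp only [envCDF, ht, if_false]
    refine le_csInf (nonempty_set a t) fun y hy => ?_
    rcases mem_insert_iff.1 hy with rfl | ⟨x, hx, rfl⟩
    · calc ⨅ r : Ioi t, envCDF ρ y₀ y₁ a r ≤ envCDF ρ y₀ y₁ a r₁ := ciInf_le hbdd _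
        _ ≤ 1 := envCDF_le_one a _
    · calc ⨅ r : Ioi t, envCDF ρ y₀ y₁ a r ≤ ⨅ r : Ioi t, (preCDF ρ r x).toReal := by
            refine ciInf_mono hbdd fun r => ?_
            simp only [envCDF, ht' r, if_false]
            exact csInf_le (bddBelow_set a r) (mem_insert_of_mem _ ⟨x, hx, rfl⟩)
        _ = (preCDF ρ t x).toReal := hx.1.2.1.iInf_rat_gt_eq t

/-- **The envelope is a rational Stieltjes point at EVERY `a`.** [this work] -/
theorem isRatStieltjesPoint_envCDF (hy : y₀ ≤ y₁) (a : ℝ) : IsRatStieltjesPoint (envCDF ρ y₀ y₁) a where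
  mono := envCDF_mono a
  tendsto_atTop_one := by
    obtain ⟨N, hN⟩ := exists_nat_ge y₁
    refine tendsto_atTop_of_eventually_const (i₀ := (N : ℚ)) fun q hq => envCDF_eq_one hy a ?_
    exact hN.trans (by exact_mod_cast hq)
  tendsto_atBot_zero := by
    obtain ⟨z, hz⟩ := exists_int_lt y₀
    refine tendsto_atBot_of_eventually_const (i₀ := (z : ℚ)) fun q hq => envCDF_eq_zero ?_
    exact lt_of_le_of_lt (by exact_mod_cast hq) hz
  iInf_rat_gt_eq := iInf_rat_gt_envCDF a

/-- The envelope is jointly measurable (antitone in `a` for each `q`). [this work] -/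
theorem measurable_envCDF : Measurable (envCDF ρ y₀ y₁) := by
  rw [measurable_pi_iff]
  intro q
  exact Antitone.measurable (fun a b hab => envCDF_anti hab q)

end Env

/-- **The envelope of `preCDF` is a rational conditional kernel CDF of `ρ`.** [this work] -/
theorem isRatCondKernelCDF_envCDF [IsFiniteMeasure ρ] (hρ : IsTP2Cut ρ) {y₀ y₁ : ℝ} (hy : y₀ ≤ y₁) (hY : ∀ᵐ p ∂ρ, p.2 ∈ Icc y₀ y₁) :
    IsRatCondKernelCDF (fun p : Unit × ℝ => envCDF ρ y₀ y₁ p.2) (Kernel.const Unit ρ) (Kernel.const Unit ρ.fst) where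
  measurable := measurable_envCDF.comp measurable_snd
  isRatStieltjesPoint_ae a := ae_of_all _ fun b =>
    (isRatStieltjesPoint_unit_prod_iff _ b).2 (isRatStieltjesPoint_envCDF hy b)
  integrable a q := by
    simp only [Kernel.const_apply]
    refine Integrable.mono' (integrable_const (1 : ℝ)) ?_ (ae_of_all _ fun b => ?_)
    · exact (measurable_envCDF.eval.aestronglyMeasurable)
    · rw [Real.norm_of_nonneg (envCDF_nonneg b q)]
      exact envCDF_le_one b q
  setIntegral a s hs q := by
    simp only [Kernel.const_apply]
    have hae : ∀ᵐ b ∂ρ.fst, b ∈ s → envCDF ρ y₀ y₁ b q = (preCDF ρ q b).toReal := by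
      filter_upwards [ae_mem_goodSet hY] with b hb using fun _ => envCDF_of_mem hρ hb q
    rw [setIntegral_congr_ae hs hae, setIntegral_preCDF_fst ρ q hs, measureReal_def, measureReal_def,
      Measure.IicSnd_apply _ _ hs]

/-- **Main construction.** A finite TP₂ measure on `ℝ × ℝ` carried by a horizontal strip `ℝ × [y₀, y₁]` admits an
EVERYWHERE stochastically increasing Markov-kernel version of its conditional law: `ρ = ρ.fst ⊗ₘ κ` with
`a ≤ b ⇒ κ_b((-∞,t]) ≤ κ_a((-∞,t])` for all real `t`. [this work] -/
theorem exists_cisKernel [IsFiniteMeasure ρ] (hρ : IsTP2Cut ρ) {y₀ y₁ : ℝ} (hy : y₀ ≤ y₁) (hY : ∀ᵐ p ∂ρ, p.2 ∈ Icc y₀ y₁) :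
    ∃ κ : Kernel ℝ ℝ, IsMarkovKernel κ ∧ ρ.fst ⊗ₘ κ = ρ ∧
      ∀ ⦃a b : ℝ⦄, a ≤ b → ∀ t : ℝ, κ b (Iic t) ≤ κ a (Iic t) := by
  set g : Unit × ℝ → ℚ → ℝ := fun p => envCDF ρ y₀ y₁ p.2 with hg
  have hf : IsRatCondKernelCDF g (Kernel.const Unit ρ) (Kernel.const Unit ρ.fst) :=
    isRatCondKernelCDF_envCDF hρ hy hY
  have hK := isCondKernelCDF_stieltjesOfMeasurableRat hf
  set K := hK.toKernel _ with hKdef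
  refine ⟨Kernel.comap K (fun a => ((), a)) measurable_prodMk_left, inferInstance, ?_, ?_⟩
  · have h2 : Kernel.prodMkLeft Unit (Kernel.comap K (fun a => ((), a)) measurable_prodMk_left) = K := by
      ext p s hs
      rcases p with ⟨u, a⟩
      rfl
    have h3 : Kernel.const Unit ρ.fst ⊗ₖ K = Kernel.const Unit ρ := compProd_toKernel hK
    rw [Measure.compProd, h2, h3, Kernel.const_apply]
  · intro a b hab t
    rw [Kernel.comap_apply, Kernel.comap_apply, hKdef, IsCondKernelCDF.toKernel_Iic, IsCondKernelCDF.toKernel_Iic]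
    refine ENNReal.ofReal_le_ofReal ?_
    have hpt : ∀ c : ℝ, IsRatStieltjesPoint g ((), c) := fun c =>
      (isRatStieltjesPoint_unit_prod_iff _ c).2 (isRatStieltjesPoint_envCDF hy c)
    have hval : ∀ c : ℝ, ∀ r : ℚ, stieltjesOfMeasurableRat g hf.measurable ((), c) r = g ((), c) r := fun c r => by
      rw [stieltjesOfMeasurableRat_eq, toRatCDF_of_isRatStieltjesPoint (hpt c)]
    rw [← StieltjesFunction.iInf_rat_gt_eq (stieltjesOfMeasurableRat g hf.measurable ((), b)) t,
      ← StieltjesFunction.iInf_rat_gt_eq (stieltjesOfMeasurableRat g hf.measurable ((), a)) t]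
    simp_rw [hval]
    have hbdd : BddBelow (range fun r : {r' : ℚ // t < r'} => g ((), b) r) :=
      ⟨0, by rintro y ⟨r, rfl⟩; exact envCDF_nonneg b r⟩
    exact ciInf_mono hbdd fun r => envCDF_anti hab r

end Summit.CriticalPhenomena.PercolationContinuityZ3.Theorems.SahiTP2
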